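import Summits.HodgeConjecture.HodgeConjecture.Theorems.F0P6bTorsionTower
import Literature.AlgebraicGeometry.GroupSchemes.BarsottiTateGroupBaseChange
import Literature.AlgebraicGeometry.GroupSchemes.BarsottiTateGroupHom
import Literature.AlgebraicGeometry.AbelianSchemes.FinsetInAffineOpenOfArtinianBase
import Literature.AlgebraicGeometry.AbelianSchemes.SerreTateCanonicalLiftFiniteSource
import Literature.AlgebraicGeometry.GroupSchemes.ReductionKernelKilledByNSquare
import Literature.AlgebraicGeometry.GroupSchemes.CartierDualQuotient
import Literature.AlgebraicGeometry.GroupSchemes.CartierDualDoubleAnnihilator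
import Literature.AlgebraicGeometry.GroupSchemes.CartierDualQuotientArtinianKernel
import Literature.AlgebraicGeometry.GroupSchemes.SubPinCompCoverClosedImmersion
import Literature.AlgebraicGeometry.AbelianSchemes.IsMonHomOfCompFaithfullyFlat
import Literature.AlgebraicGeometry.Morphisms.FpqcDescentOfMorphisms
import Literature.AlgebraicGeometry.Morphisms.FiniteBaseChangeAffine
import Literature.AlgebraicGeometry.AbelianSchemes.PDivisibleGroupOfAbelianScheme
import Literature.AlgebraicGeometry.Morphisms.ClosedImmersionOfEqualRank
import Literature.AlgebraicGeometry.GroupSchemes.SerreTateStabilisationTrivialKernel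
import Literature.AlgebraicGeometry.GroupSchemes.BarsottiTateGroupQuotientMapsDescent
import Literature.AlgebraicGeometry.AbelianSchemes.SerreTateQuotientReductionSquare
import Literature.AlgebraicGeometry.AbelianSchemes.SerreTateQuotientReductionKernel
import Literature.AlgebraicGeometry.AbelianSchemes.AbelianSchemeHomDescentKernelEq
import Literature.AlgebraicGeometry.AbelianSchemes.AbelianSchemeOverLevelBaseChange
import Literature.AlgebraicGeometry.AbelianSchemes.AbelianSchemeOverFibreIdentity
import Literature.AlgebraicGeometry.AbelianSchemes.AbelianSchemeOverMulNFiniteFlat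
import Literature.AlgebraicGeometry.AbelianSchemes.AbelianSchemeOverHomNoetherianAnyBase
import Literature.AlgebraicGeometry.AbelianSchemes.AbelianSchemeQuotientMulNDescent
import Literature.AlgebraicGeometry.GroupSchemes.SerreTateKernelFlatCover
import Literature.AlgebraicGeometry.GroupSchemes.GroupSchemeKernel
import Literature.AlgebraicGeometry.Morphisms.FlatOfComp
import Literature.AlgebraicGeometry.GroupSchemes.SerreTateDelta2OfLocalLift
import Literature.AlgebraicGeometry.GroupSchemes.BarsottiTateGroupTranslationCover
import Literature.AlgebraicGeometry.GroupSchemes.UnitComponentThickeningLift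
import Literature.AlgebraicGeometry.GroupSchemes.AffineSubtowerGlobalSections
import Literature.AlgebraicGeometry.GroupSchemes.BarsottiTateGroupUnitComponentTower
import Literature.RingTheory.AdicTopology.PowerSeriesTowerPresentation
import Literature.RingTheory.AdicTopology.SpecialFibreQuotientTransport
import Literature.AlgebraicGeometry.AbelianSchemes.SerreTateSpecialFibrePsiDatum
import Literature.AlgebraicGeometry.GroupSchemes.UnitComponentSpecialFibreStalk
import Literature.AlgebraicGeometry.GroupSchemes.UnitComponentTowerSpecialFibre
import Literature.AlgebraicGeometry.GroupSchemes.UnitComponentTowerSpecialFibreTheta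
import HarnessLib
import HarnessLib.Audit.LibrarySuggestionsDenyListCruxes

/-!
# F0 · P6b — ★ RE-HOME TWIN of the sub-line «SERRE–TATE σ2», PART 1∕3: the organs E1 (β-tower), KD2 (δ₂-lift) and E2a (kernel of `β₂` finite flat)

HC_CM is proved only modulo the printed citations until rung 0 closes; this twin changes no count (count-neutral ★ on
`--supports stmt-HodgeConjecture-24832`).  Every statement and proof body below is copied VERBATIM from the crux workfile
`Cruxes/HLiu418/Lines/F0_P6b_SerreTateSigma2.lean` ED. 5 (commit 18dc629bc214, sha16 1b5126d83441851a; full history in its module docstring);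
ONLY the namespace (`…Cruxes.HLiu418.F0P6bSigma2`, shared by the three parts), the sibling imports (`Lines.F0_P6b_*` ↦ `Theorems.F0P6b*`) and the
qualified sibling names are renamed, and the 868-line file is SPLIT IN THREE to meet the 400-line Theorems lint (desk F0P6b-plan (g14), LEAD «M-153u»).
Sorry-free; axioms of every theorem = [propext, Classical.choice, Quot.sound].

Content of this part (MOD-PLAN v0.9 Row 4, road 4B; [Katz1981SerreTate] §1, [MessingBT1972]): §E1 `stub_L4B1esB_betaTower` — the canonical lift
«`p · α⁻¹`» of the kernel embeddings into the abelian lift `Y`; §KD2 `stub_L4B1esKD_deltaTwoLift` — the δ₂-lift `Y[p²] → B[p²]` killed by `β₂`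
(the formal-Lie-group chain, PAID BY ★ TERM in ED. 5); §E2a `stub_L4B1esK_kernelFiniteFlat` — the kernel of `β₂` is a finite FLAT closed subgroup.
Parts 2∕3 = `Theorems/F0P6bSigma2Quotient.lean` (E2b, E3), 3∕3 = `Theorems/F0P6bSigma2.lean` (E4 + the head `stub_L4B1es_of_sigma2`).
-/

noncomputable section

set_option autoImplicit false
set_option linter.dupNamespace false

open CategoryTheory CategoryTheory.Limits AlgebraicGeometry MonoidalCategory CartesianMonoidalCategory IsLocalRing
open scoped MonObj

namespace Summit.HodgeConjecture.HodgeConjecture.Cruxes.HLiu418.F0P6bSigma2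

open Literature.AlgebraicGeometry.GroupSchemes Literature.AlgebraicGeometry.AbelianSchemes Literature.AlgebraicGeometry

/-! ## §E1 The canonical lift «`p · α⁻¹`» of the kernel embeddings INTO the abelian lift `Y` -/

/-- **stub E1 «β-TOWER» ([Katz1981SerreTate] Lemma 1.1.3 (3), `N = p`, `ν = 1`, source the finite flat layers `B[pⁿ]`, target the
ABELIAN lift `Y`).**  In the socket's setting, for any abelian `Y ∕ A` with a base-change square `GY : X₀ → Y` over `Spec (A⧸J) ↪ Spec A`,
there are HOMOMORPHISMS `β n : B[pⁿ] → Y` over `A`, compatible with the transitions `B[pⁿ] ↪ B[pⁿ⁺¹]`, whose reductions are `p ·` (the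
kernel embeddings): `c n ≫ β n = (i₀ n)^p ≫ GY` on underlying schemes.  Plausibly TRUE and ★-provable (M): `B[pⁿ] = Spec` of a finite
`A`-algebra is affine with finitely many points, whose images lie in ONE affine open of `Y` (★ (E0)
`AbelianSchemeOver.exists_isAffineOpen_forall_mem_of_isArtinianRing`), so a local lift of `(i₀ n) ≫ GY` exists (★
`Deformation.exists_lift_of_smooth_affine`, `Y` smooth); its `p`-th power is independent of the lift (★ `ReductionKernel.pow_eq_one_of_isPullback`,
`J² = 0`, `p · J = 0`), hence a homomorphism compatible with `incl` (uniqueness; ★ `SerreTate.pow_eq_pow_of_comp_eq` pattern).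
[cite: Katz1981SerreTate, §1.1 Lemma 1.1.3 (3) and its proof (pp. 139–140)] [cite: Tate1967, §2 (2.1)] -/
theorem stub_L4B1esB_betaTower :
    ∀ (p : ℕ), p.Prime → ∀ (A : Type) [CommRing A] [IsArtinianRing A] [IsLocalRing A], IsNilpotent (p : A) →
      ∀ (J : Ideal A), J ≠ ⊤ → maximalIdeal A * J = ⊥ →
      ∀ (g : ℕ) (X₀ : AbelianSchemeOver (Spec (.of (A ⧸ J)))), X₀.IsOfRelDim g →
      ∀ (B₀ : BTGroup (Spec (.of (A ⧸ J))) p (2 * g)) (i₀ : ∀ n, B₀.G n ⟶ X₀.X), F0P6bTorsionTower.IsTorsionTower X₀ B₀ i₀ →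
      ∀ (B : BTGroup (Spec (.of A)) p (2 * g)) (c : ∀ n, (B₀.G n).left ⟶ (B.G n).left),
        B₀.IsBaseChangeVia B (Spec.map (CommRingCat.ofHom (Ideal.Quotient.mk J))) c →
      ∀ (Y : AbelianSchemeOver (Spec (.of A))), Y.IsOfRelDim g → ∀ (GY : X₀.X.left ⟶ Y.X.left),
        X₀.IsBaseChangeVia Y (Spec.map (CommRingCat.ofHom (Ideal.Quotient.mk J))) GY →
        ∃ β : ∀ n, B.G n ⟶ Y.X, (∀ n, letI := B.grpObj n; IsMonHom (β n)) ∧ (∀ n, B.incl n ≫ β (n + 1) = β n) ∧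
          ∀ n, c n ≫ (β n).left = ((i₀ n) ^ p).left ≫ GY := by
  -- ED. 3: PAID BY ★ TERM — Drinfeld's canonical `p`-th power lift with FINITE source (★ `SerreTate.exists_powLift_of_isFinite`,
  -- wave-A seat P6b-A2 «L1» LA1-p02 (g10)) and the finite-source lifting lemma (★ `SerreTate.exists_lift_of_isFinite`); the Katz
  -- hypothesis is ★ `ReductionKernel.pow_eq_one_of_isPullback` (`J² = 0` from `𝔪·J = 0`, `p·J = 0` from `p ∈ 𝔪`); the transition rule
  -- is the EVALUATION RULE of `β (n+1)` at `incl n` and of `β n` at `𝟙` against ONE lift of `i₀ n` (desk F0P6b-plan (g13) junction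
  -- `F0P6bSigma2BetaTower.stub_L4B1esB_of_powLift`, HOME cand 6f92b983f78f3011, inlined here).
  intro p hp A _ _ _ hpA J hJtop hmJ g X₀ hX₀ B₀ i₀ hT B c hB Y hY GY hGY
  have hJJ : J * J = ⊥ :=
    le_bot_iff.mp ((Ideal.mul_mono_left (le_maximalIdeal hJtop)).trans hmJ.le)
  have hpJ : ∀ a ∈ J, (p : A) * a = 0 := by
    intro a ha
    have hpm : (p : A) ∈ maximalIdeal A := by
      rw [mem_maximalIdeal, mem_nonunits_iff]
      intro hu
      obtain ⟨k, hk⟩ := hpA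
      exact not_isUnit_zero (hk ▸ hu.pow k)
    have hmem : (p : A) * a ∈ maximalIdeal A * J := Ideal.mul_mem_mul hpm ha
    rwa [hmJ, Ideal.mem_bot] at hmem
  obtain ⟨hTmon, -, hTincl⟩ := hT
  -- the Katz hypothesis for `Y`, `N := p` (★ Drinfeld rigidity, first-order case)
  have hK : ∀ ⦃W' : Over (Spec (.of A))⦄ ⦃W'₀ : Scheme.{0}⦄ (ρ : W'₀ ⟶ W'.left) (b : W'₀ ⟶ Spec (.of (A ⧸ J))),
      IsPullback ρ b W'.hom (Spec.map (CommRingCat.ofHom (Ideal.Quotient.mk J))) →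
      ∀ q : W' ⟶ Y.X, ρ ≫ q.left = ρ ≫ (1 : W' ⟶ Y.X).left → q ^ p = 1 :=
    fun W' W'₀ ρ b hρ q hq => ReductionKernel.pow_eq_one_of_isPullback hJJ hpJ ρ b hρ q hq
  -- the canonical lifts, layer by layer (★ finite-source `exists_powLift`)
  have hex : ∀ n, ∃ Nf : B.G n ⟶ Y.X, (letI := B.grpObj n; IsMonHom Nf) ∧ c n ≫ Nf.left = ((i₀ n) ^ p).left ≫ GY ∧
      ∀ ⦃W' : Over (Spec (.of A))⦄ ⦃W'₀ : Scheme.{0}⦄ (ρ : W'₀ ⟶ W'.left) (b : W'₀ ⟶ Spec (.of (A ⧸ J))),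
        IsPullback ρ b W'.hom (Spec.map (CommRingCat.ofHom (Ideal.Quotient.mk J))) →
        ∀ (x : W' ⟶ B.G n) (y : W' ⟶ Y.X) (x₀ : W'₀ ⟶ (B₀.G n).left), x₀ ≫ c n = ρ ≫ x.left → x₀ ≫ (B₀.G n).hom = b →
          ρ ≫ y.left = x₀ ≫ (i₀ n).left ≫ GY → x ≫ Nf = y ^ p := by
    intro n
    letI := B.grpObj n
    letI := B₀.grpObj n
    haveI : IsFinite (B.G n).hom := B.isFinite n
    haveI : IsMonHom (i₀ n) := hTmon n
    exact SerreTate.exists_powLift_of_isFinite A J hJJ p (B.G n) (B₀.G n) (c n) (hB.1 n) Y X₀ GY hGY (i₀ n) inferInstance hK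
  choose β hβmon hβred hβev using hex
  refine ⟨β, hβmon, fun n => ?_, hβred⟩
  -- transition rule: evaluate `β (n+1)` at `incl n` and `β n` at `𝟙` against ONE lift `y` of `i₀ n` (★ finite-source lifting)
  letI := B.grpObj n
  letI := B₀.grpObj n
  haveI : IsFinite (B.G n).hom := B.isFinite n
  obtain ⟨w, hpb, -, -⟩ := hB.1 n
  obtain ⟨y, hy⟩ := SerreTate.exists_lift_of_isFinite A J hJJ (B.G n) (B₀.G n) (c n) hpb Y X₀ GY hGY (i₀ n)
  have h1 : 𝟙 (B.G n) ≫ β n = y ^ p :=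
    hβev n (c n) (B₀.G n).hom hpb (𝟙 (B.G n)) y (𝟙 (B₀.G n).left) (by simp) (by simp) (by simpa using hy)
  have h2 : B.incl n ≫ β (n + 1) = y ^ p := by
    refine hβev (n + 1) (c n) (B₀.G n).hom hpb (B.incl n) y (B₀.incl n).left (hB.2 n) (Over.w (B₀.incl n)) ?_
    rw [hy, ← Over.comp_left_assoc, hTincl n]
  rw [h2, ← h1, Category.id_comp]

/-! ## §E2a∕KD2 (ED. 4) The δ₂-LIFT: the ONE open leaf of №2 — a morphism `δ₂ : Y[p²] → B[p²]` killed by `β₂` and reducing to `p · ε₂⁻¹` -/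

/-- **stub KD2 «δ₂-LIFT» (ED. 4; the ONE open leaf of E2a after ★ A6 `SerreTateKernel.exists_flat_surjective_torsion_to_kernel`).**  In E2a's
setting, for ANY reduction map `j : X₀[p²] → Y[p²]` over `GY` WITH its cartesian square over `Spec (A⧸J) ↪ Spec A` (binder `hjc`, ED. 4 v2:
verbatim the binder of ★ `SerreTateKernel.exists_delta2_of_localLift`; E2a has it from ★ `exists_torsion_isPullback`) and ANY kernel comparison `e : X₀[p²] → B₀[p²]` over `i₀ 2`, there is a morphism of
`A`-schemes `δ₂ : Y[p²] → B[p²]` (no homomorphy asked) KILLED BY `β 2` and REDUCING modulo `J` to `p · e` along `c 2`: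
`j ≫ δ₂ = e^p ≫ c 2` on underlying schemes.  Road (W1′ (s2), canonical-power gluing, Messing-free): fppf-locally on `Y[p²]` (B4's TRANSLATION
COVER `V ↠ Y[p²]`, finite flat, ★ `BarsottiTateGroupTranslationCover`) the point `p · ε₂⁻¹` of `B₀[p²]` lifts to `B[p^m]` through the UNIT
COMPONENT (B4 S1, B7 `hlift` = ★ `AdicTopology.exists_algHom_lift_of_iInf_ker_eq_bot` over B2's ★ `PowerSeriesTowerPresentation` of the
unit-component tower, special fibre by ★ `RegularLocalRing.PowerSeriesQuotientTower` + ★ `Motives.AbelianVarietyTorsionStalkTower`); the `p`-th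
power of any local lift is INDEPENDENT of the lift (★ `ReductionKernel.pow_eq_one_of_isPullback`, `J² = 0`, `p · J = 0`) hence DESCENDS along
the cover (B6 ★ `PowerLiftFpqcDescent`: `existsUnique_desc_pow_of_localLift`, `pow_comp_eq_pow_comp_of_localLifts`) to `δ₂`; `β 2 ∘ δ₂ =
(β 2 ∘ lift)^p` reduces to `(p · i₀ 2 ∘ p ε₂⁻¹)` … `= [p²] ∘ ι = 1` and is itself a `p`-th power of a lift of a `J`-unit ⇒ `= 1` by the same ★.
Why it might fail: the unit-component lifting needs the power-series presentation of `(B[pⁿ])⁰` COMPATIBLY in `n` (B2's `hcof`∕`⨅ ker = ⊥`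
clause) — in print only via Messing's formal smoothness; the bet is the Artinian-base tower presentation (B2∕B3∕B3′ ★) suffices.  Size L.
PAYMENT (ED. 5, by TERM, no new statement): ★ `SerreTateKernel.exists_delta2_of_localLift` (B6 «L3» LA3-p03 (g8), p853946; its binders =
these with `IsTorsionTower` unfolded, `K iK` := `ker (β 2)` rebuilt as in E2a, + the SPINE hypothesis) with the spine discharged by ★
`BTGroup.exists_finiteFlat_cover_lift` (B4 S7 p853932) over ★ `UnitComponentThickeningLift` (B7) ∘ ★ `PowerSeriesTowerPresentation` (B2 (B) p853942)
∘ the unit-component sub-tower organs S1-geo ∕ S1-alg ∕ S1′ (DEALS v8 d3∕d4; LA-ref1 (g7) kernel tie 09:21:42Z: the spine's open set is exactly S1).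
[cite: Katz1981SerreTate, proof of Theorem 1.2.1 (§1.2, pp. 141–142) and Lemma 1.1.2, Lemma 1.1.3 (3)] [cite: GortzWedhorn2020, Thm. 14.72] -/
theorem stub_L4B1esKD_deltaTwoLift :
    ∀ (p : ℕ), p.Prime → ∀ (A : Type) [CommRing A] [IsArtinianRing A] [IsLocalRing A], IsNilpotent (p : A) →
      ∀ (J : Ideal A), J ≠ ⊤ → maximalIdeal A * J = ⊥ →
      ∀ (g : ℕ) (X₀ : AbelianSchemeOver (Spec (.of (A ⧸ J)))), X₀.IsOfRelDim g →
      ∀ (B₀ : BTGroup (Spec (.of (A ⧸ J))) p (2 * g)) (i₀ : ∀ n, B₀.G n ⟶ X₀.X), F0P6bTorsionTower.IsTorsionTower X₀ B₀ i₀ →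
      ∀ (B : BTGroup (Spec (.of A)) p (2 * g)) (c : ∀ n, (B₀.G n).left ⟶ (B.G n).left),
        B₀.IsBaseChangeVia B (Spec.map (CommRingCat.ofHom (Ideal.Quotient.mk J))) c →
      ∀ (Y : AbelianSchemeOver (Spec (.of A))), Y.IsOfRelDim g → ∀ (GY : X₀.X.left ⟶ Y.X.left),
        X₀.IsBaseChangeVia Y (Spec.map (CommRingCat.ofHom (Ideal.Quotient.mk J))) GY →
      ∀ (β : ∀ n, B.G n ⟶ Y.X), (∀ n, letI := B.grpObj n; IsMonHom (β n)) → (∀ n, B.incl n ≫ β (n + 1) = β n) →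
        (∀ n, c n ≫ (β n).left = ((i₀ n) ^ p).left ≫ GY) →
      ∀ (j : Over.mk ((X₀.torsion (p ^ 2)).hom ≫ Spec.map (CommRingCat.ofHom (Ideal.Quotient.mk J))) ⟶ Y.torsion (p ^ 2)),
        j.left ≫ (Y.torsionι (p ^ 2)).left = (X₀.torsionι (p ^ 2)).left ≫ GY →
        IsPullback j.left (X₀.torsion (p ^ 2)).hom (Y.torsion (p ^ 2)).hom
          (Spec.map (CommRingCat.ofHom (Ideal.Quotient.mk J))) →
      ∀ (e : X₀.torsion (p ^ 2) ⟶ B₀.G 2), e ≫ i₀ 2 = X₀.torsionι (p ^ 2) →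
        ∃ δ₂ : Y.torsion (p ^ 2) ⟶ B.G 2, δ₂ ≫ β 2 = 1 ∧
          j.left ≫ δ₂.left = (letI := B₀.grpObj 2; (e ^ p).left) ≫ c 2 := by
  open Literature.RingTheory.AdicTopology Literature.AlgebraicGeometry.Motives
    Literature.AlgebraicGeometry.Motives.AbelianVariety in
  intro p hp A _ _ _ hpA J hJ hmJ g X₀ hX₀ B₀ i₀ hT B c hBc Y hY GY hGY β hβ₁ hβ₂ hβ₃ j hj hjc e he
  -- `(p : κ(A)) = 0` and `J ⊆ nil(A)` from the small-extension arithmetic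
  have hp0 : ((p : ℕ) : ResidueField A) = 0 := by
    have h := hpA.map (IsLocalRing.residue A)
    rw [map_natCast] at h
    exact h.eq_zero
  have hJnil : (J : Set A) ⊆ nilradical A := by
    intro a ha
    refine ⟨2, ?_⟩
    have : a * a ∈ maximalIdeal A * J := Ideal.mul_mem_mul (IsLocalRing.le_maximalIdeal hJ ha) ha
    rw [hmJ] at this
    simpa [pow_two] using this
  -- K := Ker (β 2) (as in the ED. 4 junction)
  haveI := Y.isProper
  haveI hKc : IsClosedImmersion (GroupSchemeKernel.kerι (β 2)).left :=
    GroupSchemeKernel.isClosedImmersion_kerι_left_of_isSeparated (β 2)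
  have hKf : IsFinite (GroupSchemeKernel.ker (β 2)).hom := by
    rw [← Over.w (GroupSchemeKernel.kerι (β 2))]
    haveI := B.isFinite 2
    infer_instance
  have hKer : ∀ (T : Over (Spec (.of A))) (u : T ⟶ B.G 2), u ≫ β 2 = 1 ↔ ∃ v : T ⟶ GroupSchemeKernel.ker (β 2),
      v ≫ GroupSchemeKernel.kerι (β 2) = u := by
    intro T u
    constructor
    · intro hu
      exact ⟨GroupSchemeKernel.kerLift u hu, GroupSchemeKernel.kerLift_ι u hu⟩
    · rintro ⟨v, rfl⟩
      rw [Category.assoc, GroupSchemeKernel.kerι_comp, MonObj.comp_one]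
  have hT3 : (∀ n, letI := B₀.grpObj n; IsMonHom (i₀ n)) ∧
      (∀ n, IsPullback (i₀ n) (toUnit (B₀.G n)) (((𝟙 X₀.X : X₀.X ⟶ X₀.X) ^ (p ^ n) : X₀.X ⟶ X₀.X)) η[X₀.X]) ∧
      (∀ n, B₀.incl n ≫ i₀ (n + 1) = i₀ n) := hT
  refine SerreTateKernel.exists_delta2_of_localLift p hp A hpA J hJ hmJ g X₀ hX₀ B₀ i₀ hT3 B c hBc Y hY GY hGY β hβ₁ hβ₂ hβ₃
    (GroupSchemeKernel.ker (β 2)) (GroupSchemeKernel.kerι (β 2)) hKc hKf hKer j hj hjc e he ?_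
  -- THE SPINE at `T := Y[p²]`, `n := 2`
  intro T₀ ρ b hρ u₀ hu₀
  -- S1-geo ★: the unit-component sub-tower
  obtain ⟨G₀, instG, jG, incl₀, hjm, hjo, hjc', hconn, haff, hfin, hfl, hunit, hιj, hιc, hιS, hι_refl, hι_trans⟩ :=
    B.exists_unitComponentTower
  haveI : ∀ n, IsAffine (G₀ n).left := haff
  -- S1-alg ★: global sections, finite free, `Γ(incl₀)` surjective
  letI alg : ∀ n, Algebra A Γ((G₀ n).left, ⊤) :=
    fun n => (((G₀ n).hom.appTop).hom.comp (Scheme.ΓSpecIso (.of A)).inv.hom).toAlgebra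
  obtain ⟨hF, hFr, ρE, hρΓ, hρ_refl, hρ_trans, hρ_surj⟩ :=
    exists_algHom_tower_of_affine_subtower G₀ hfin hfl incl₀ hιS hι_refl (fun _ _ _ h₁ h₂ => hι_trans _ _ _ h₁ h₂) hιc
  haveI := hF; haveI := hFr
  -- B8 ★: the special-fibre ψ-datum of the closed fibre `X_κ`
  obtain ⟨ψ, hψπ, hψC', hψ_surj, hψX, hψ_ker⟩ :=
    AbelianSchemeOver.exists_ringHom_mvPowerSeries_torsionStalkTower_closedFibre p hp hpA hJ X₀ hX₀
  -- S1′ ★ (σ)+(τ)+HEAD: the θ-datum of the unit-component tower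
  obtain ⟨θ, hθρ, hθc⟩ :=
    BTGroup.exists_theta_specialFibre_unitComponentTower hp0 hJ X₀ B₀ i₀
      hT.1 hT.2.1 hT.2.2 B c hBc G₀ instG jG incl₀ hjm hjo hconn haff hfin hιj
  -- S1′-α ★: the reduction maps `r n`
  have hθρ' : ∀ ⦃n m : ℕ⦄ (h : n ≤ m) (x : Γ((G₀ m).left, ⊤)),
      θ n (Ideal.Quotient.mk _ (ρE h x)) =
        Ideal.Quotient.factor
          ((AbelianSchemeOver.closedFibre hJ X₀).toAffine.toAbelianVariety.antitone_torsionStalkIdeal hp0 h)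
          (θ m (Ideal.Quotient.mk _ x)) := fun n m h x => by
    have hx : ρE h x = ((incl₀ h).appTop).hom x := RingHom.congr_fun (hρΓ n m h) x
    rw [hx]; exact hθρ h x
  obtain ⟨r, hr_surj, hr_ker, hrρ, hψC⟩ :=
    PowerSeriesTower.exists_specialFibre_transport A (fun n => Γ((G₀ n).left, ⊤)) ρE
      (fun n => ↥(stalkOrigin (AbelianSchemeOver.closedFibre hJ X₀).toAffine.toAbelianVariety) ⧸
        (maximalIdeal (stalkOrigin (AbelianSchemeOver.closedFibre hJ X₀).toAffine.toAbelianVariety)).map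
          (stalkMapEnd (AbelianSchemeOver.closedFibre hJ X₀).toAffine.toAbelianVariety
            (((p ^ n : ℕ) : ℤ) • 𝟙 (AbelianSchemeOver.closedFibre hJ X₀).toAffine.toAbelianVariety)).hom)
      (fun n m h => Ideal.Quotient.factor
        ((AbelianSchemeOver.closedFibre hJ X₀).toAffine.toAbelianVariety.antitone_torsionStalkIdeal hp0 h))
      (IsLocalRing.residue A)
      (fun n => (Ideal.Quotient.mk _).comp
        (stalkOriginAlgebraMap (AbelianSchemeOver.closedFibre hJ X₀).toAffine.toAbelianVariety))
      ψ hψC' θ hθρ' hθc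
  -- B2 (B) ★: the power-series presentation of the unit-component tower
  obtain ⟨φ, hφρ, hφ, hX, hker, -⟩ :=
    PowerSeriesTower.exists_compatible_surjective_algHom_of_specialFibre A (σ := Fin g)
      (fun n => Γ((G₀ n).left, ⊤)) ρE hρ_refl hρ_trans hρ_surj _ _ r hr_surj hr_ker hrρ (IsLocalRing.residue A)
      IsLocalRing.residue_surjective IsLocalRing.ker_residue ψ hψπ hψC hψ_surj hψX hψ_ker
  -- B7 ★ (ED. 3): `hlift`
  have hlift := subtower_liftsAlong_of_iInf_ker_eq_bot_of_appTop B G₀ jG incl₀ hιj (fun n => (φ n).toRingHom)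
    (fun n => (φ n).comp_algebraMap) (fun n m h => by rw [← hρΓ n m h]; exact congrArg AlgHom.toRingHom (hφρ n m h))
    (fun n => hφ n) (fun n s => hX n s) hker J hJnil
  -- S7 ★: the translation cover at `T := Y[p²]`, `n := 2`
  haveI : IsAffine (Y.torsion (p ^ 2)).left := by
    haveI := Y.isFinite_torsion_hom (pow_ne_zero 2 hp.ne_zero)
    exact isAffine_of_isAffineHom (Y.torsion (p ^ 2)).hom
  obtain ⟨V, cV, hVaff, hf, hfl', hs, m, hm, Fm, hF⟩ :=
    B.exists_finiteFlat_cover_lift J hJnil G₀ jG hjo hjc' hunit hlift (Y.torsion (p ^ 2)) T₀ ρ b hρ 2 u₀ hu₀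
  exact ⟨V, cV, hVaff, hf, hfl', hs, m, hm, Fm, hF⟩

/-! ## §E2a «O-flat», the core: the kernel of `β₂` is a finite FLAT subgroup scheme (THE HARD ORGAN) -/

/-- **stub E2a «O-FLAT ∕ KERNEL» ([Katz1981SerreTate] proof of Thm. 1.2.1, p. 142: «… an isogeny … `K` is a finite flat subgroup»; here
for the lift INTO `Y`: `Ker (β 2) = «p·α»(Y[p²]) ≅ Y[p²] ⧸ Ker «p·α»`, of rank `p^{2g}`, lifting `B₀[p]`).**  In the setting of E1 and for any
`β` with E1's three properties (such a `β` is UNIQUE): the kernel of the homomorphism `β 2 : B[p²] → Y` — always a finite closed subgroup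
scheme `iK : K ↪ B[p²]` (`K = B[p²] ×_Y e`) — is FLAT over `A`; stated as: a finite flat closed `K` through which exactly the `T`-points killed
by `β 2` factor.  STABILISATION (Messing-free): `Ker (β n) = K` for all `n ≥ 2` (a point of `Ker (β n)` reduces into `Ker (p · i₀ n) =
B₀[p]`, so its `p`-th power is trivial modulo `J` in the finite flat group `B[pⁿ]`, hence killed by `p` by ★
`ReductionKernel.pow_eq_one_of_isPullback` (`J² = 0`, `p · J = 0`; ANY monoid scheme over a local base), i.e. `Ker (β n) ⊂ B[p²]` by ★
`BTGroup.isPullback_incl`).  Why it might fail ∕ cost: TRUE (Drinfeld); the printed proof is the fibre-by-fibre flatness criterion on FORMAL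
LIE VARIETIES — free for `Ŷ` (`Y` smooth), [Messing1972] Ch. II (3.3.13)∕(3.3.18) for `B̂` = the class of the tree's unproved named fact
`BTGroup.Messing1972_isFormallySmooth_of_isNilpotent`; a Messing-free proof over the ARTINIAN base (flat ⟺ free ⟺ `ℓ_A 𝒪(K) = p^{2g} ℓ(A)`;
McCoy: an injective map of finite free modules over an Artinian local ring splits; `K` flat ⟺ `pMap⁻¹ K = (β 3)⁻¹(Y[p])` flat, ★
`BTGroup.flat_pMap` + faithfully flat descent) is not in print to our knowledge.  WARNING: `Ker (β 1) = K ∩ B[p]` is NOT flat in general (the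
Serre–Tate twist) — no layerwise fibrewise shortcut; two-exact-sequence length arguments are circular. (L+; G5-class.)
[cite: Katz1981SerreTate, proof of Theorem 1.2.1 (§1.2, pp. 141–142) and Lemma 1.1.2] [cite: Messing1972, Ch. II Thm. (3.3.13)] -/
theorem stub_L4B1esK_kernelFiniteFlat :
    ∀ (p : ℕ), p.Prime → ∀ (A : Type) [CommRing A] [IsArtinianRing A] [IsLocalRing A], IsNilpotent (p : A) →
      ∀ (J : Ideal A), J ≠ ⊤ → maximalIdeal A * J = ⊥ →
      ∀ (g : ℕ) (X₀ : AbelianSchemeOver (Spec (.of (A ⧸ J)))), X₀.IsOfRelDim g →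
      ∀ (B₀ : BTGroup (Spec (.of (A ⧸ J))) p (2 * g)) (i₀ : ∀ n, B₀.G n ⟶ X₀.X), F0P6bTorsionTower.IsTorsionTower X₀ B₀ i₀ →
      ∀ (B : BTGroup (Spec (.of A)) p (2 * g)) (c : ∀ n, (B₀.G n).left ⟶ (B.G n).left),
        B₀.IsBaseChangeVia B (Spec.map (CommRingCat.ofHom (Ideal.Quotient.mk J))) c →
      ∀ (Y : AbelianSchemeOver (Spec (.of A))), Y.IsOfRelDim g → ∀ (GY : X₀.X.left ⟶ Y.X.left),
        X₀.IsBaseChangeVia Y (Spec.map (CommRingCat.ofHom (Ideal.Quotient.mk J))) GY →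
      ∀ (β : ∀ n, B.G n ⟶ Y.X), (∀ n, letI := B.grpObj n; IsMonHom (β n)) → (∀ n, B.incl n ≫ β (n + 1) = β n) →
        (∀ n, c n ≫ (β n).left = ((i₀ n) ^ p).left ≫ GY) →
        ∃ (K : Over (Spec (.of A))) (iK : K ⟶ B.G 2), IsClosedImmersion iK.left ∧ IsFinite K.hom ∧ Flat K.hom ∧
          ∀ (T : Over (Spec (.of A))) (u : T ⟶ B.G 2), u ≫ β 2 = 1 ↔ ∃ v : T ⟶ K, v ≫ iK = u := by
  -- ED. 4 (desk F0P6b-plan (g13)): E2a REDUCED to the ONE named leaf KD2 `stub_L4B1esKD_deltaTwoLift` over ★ A6 (F0P2-p01 (g30))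
  -- `SerreTateKernel.exists_flat_surjective_torsion_to_kernel` (flat surjective `δ : Y[p²] ↠ K` from a δ₂-datum; fibre criterion on the
  -- REVERSE lift) + its ★ helpers `exists_torsion_isPullback` ∕ `exists_torsion_comparison`; `K := Ker (β 2)` (★ `GroupSchemeKernel`), flat by
  -- descent of flatness along the flat surjective `δ` from the flat `Y[p²]` (★ `Morphisms.Flat.of_comp_of_surjective`).
  intro p hp A _ _ _ hpA J hJ hmJ g X₀ hX₀ B₀ i₀ hT B c hBc Y hY GY hGY β hβ₁ hβ₂ hβ₃
  -- K := Ker (β 2), a closed finite subscheme with the kernel property (KF0)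
  haveI := Y.isProper
  haveI hKc : IsClosedImmersion (GroupSchemeKernel.kerι (β 2)).left :=
    GroupSchemeKernel.isClosedImmersion_kerι_left_of_isSeparated (β 2)
  have hKf : IsFinite (GroupSchemeKernel.ker (β 2)).hom := by
    rw [← Over.w (GroupSchemeKernel.kerι (β 2))]
    haveI := B.isFinite 2
    infer_instance
  have hKer : ∀ (T : Over (Spec (.of A))) (u : T ⟶ B.G 2), u ≫ β 2 = 1 ↔ ∃ v : T ⟶ GroupSchemeKernel.ker (β 2),
      v ≫ GroupSchemeKernel.kerι (β 2) = u := by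
    intro T u
    constructor
    · intro hu
      exact ⟨GroupSchemeKernel.kerLift u hu, GroupSchemeKernel.kerLift_ι u hu⟩
    · rintro ⟨v, rfl⟩
      rw [Category.assoc, GroupSchemeKernel.kerι_comp, MonObj.comp_one]
  -- the reduction map `j` of `Y[p²]` and the kernel comparison `e` (★ A6 helpers)
  haveI : IsClosedImmersion (Spec.map (CommRingCat.ofHom (Ideal.Quotient.mk J))) :=
    @IsClosedImmersion.spec_of_quotient_mk (.of A) J
  have hT3 : (∀ n, letI := B₀.grpObj n; IsMonHom (i₀ n)) ∧
      (∀ n, IsPullback (i₀ n) (toUnit (B₀.G n)) (((𝟙 X₀.X : X₀.X ⟶ X₀.X) ^ (p ^ n) : X₀.X ⟶ X₀.X)) η[X₀.X]) ∧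
      (∀ n, B₀.incl n ≫ i₀ (n + 1) = i₀ n) := hT
  obtain ⟨j, hj, hjc⟩ := SerreTateKernel.exists_torsion_isPullback hGY (p ^ 2)
  obtain ⟨e, he⟩ := SerreTateKernel.exists_torsion_comparison X₀ (p ^ 2) (i₀ 2) (hT3.2.1 2)
  -- the δ₂-lift (KD2, the ONE open leaf)
  obtain ⟨δ₂, hδ₂β, hδ₂red⟩ := stub_L4B1esKD_deltaTwoLift p hp A hpA J hJ hmJ g X₀ hX₀ B₀ i₀ hT B c hBc Y hY GY hGY β hβ₁ hβ₂ hβ₃ j hj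
    hjc e he
  -- the flat surjective cover `δ : Y[p²] ↠ K` (★ A6)
  obtain ⟨δ, hδf, hδs⟩ := SerreTateKernel.exists_flat_surjective_torsion_to_kernel p hp A hpA J hJ hmJ g X₀ hX₀ B₀ i₀ hT B c hBc Y hY
    GY hGY β hβ₁ hβ₂ hβ₃ (GroupSchemeKernel.ker (β 2)) (GroupSchemeKernel.kerι (β 2)) hKc hKf hKer j hj e he δ₂ hδ₂β hδ₂red
  refine ⟨GroupSchemeKernel.ker (β 2), GroupSchemeKernel.kerι (β 2), hKc, hKf, ?_, hKer⟩
  -- flatness descends along the flat surjective `δ` from the flat `Y[p²]`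
  have hp2 : p ^ 2 ≠ 0 := pow_ne_zero 2 hp.ne_zero
  haveI : Flat (Y.torsion (p ^ 2)).hom := Y.flat_torsion_hom hp2
  haveI : Flat (δ.left ≫ (GroupSchemeKernel.ker (β 2)).hom) := by rw [Over.w δ]; infer_instance
  haveI := hδf
  haveI := hδs
  exact Morphisms.Flat.of_comp_of_surjective δ.left (GroupSchemeKernel.ker (β 2)).hom

end Summit.HodgeConjecture.HodgeConjecture.Cruxes.HLiu418.F0P6bSigma2
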